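import Summits.CriticalPhenomena.PercolationContinuityZ3.Theorems.PercNearOneGluingNoHeavyLowerTailSahiLatinZeroBottomCore

/-!
# `NoHeavyLowerTail` (crux stmt-CriticalPhenomena-4575), Sahi programme (prim-master-conj gen 49): THE SINGLE-BRIDGE CORE — the grid invariant
# `Grid4` holds for the four core instances on `[3]^2` (`P = {x₀ ≥ t₀}`, `Q = {x₁ ≥ t₁}`, `b = Pᶜ`, `c = Qᶜ`, `t₀, t₁ ∈ {1,2}`)

Support file (`--supports stmt-CriticalPhenomena-4575`; small computable definitions + proofs by `decide` on the 9-point grid `[3]^2`,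
no `sorry`, standard axioms — `decide`, not `native_decide`; the instance-size options only let Lean synthesise the `Decidable` instance of the
144-case pattern check).  Memo `run/shared/lean/prim/prim-l12/FROM-prim-master-conj-g49-PEELING-THEOREM.md` §4.

THE MATHEMATICS.  The base case of the PEELING THEOREM for the single-bridge family: after all primed and free coordinates are peeled off
(pairing lemmas of `…ZeroBottomGrid`), a conjunctive zero-bottom instance with ONE unprimed literal on each side is the CORE instance on
`[3]^{Fin 2}` with `P = {x : t₀ ≤ x 0}`, `P′ = Ω` (so `b = Ω ∖ P`), `Q = {x : t₁ ≤ x 1}`, `Q′ = Ω` (`c = Ω ∖ Q`).  THEOREM (`grid4_core11_22`,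
`_21`, `_12`, `_11`): `Grid4 P b Q c` for the four threshold pairs.  Proof: the pointwise relaxation `grid4_of_pointwise` of `…ZeroBottomCore`
with the per-point minimum `mPat` over the admissible membership patterns (a computable function, general `κ`); on `[3]^2` both hypotheses —
the pattern inequalities and `0 ≤ Σ_u mPat(u)` (the sum is `0` for `(t₀,t₁) = (2,2), (1,1)`: the bridge is TIGHT, and `4` for the mixed
thresholds) — are finite computations discharged by `decide`.  Consequence (with the pairing lemmas and `psi_nonneg_of_grid4`,
`three_kappa_top_le_iff_psi_nonneg`): top-slice dominance with the sharp constant `3/2` (`4c₁ ≥ 3c₃`, the lower-step form of prim-ineq-gen-4's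
(C¼)) on the whole single-bridge family with arbitrary primed/free padding — assembled in the companion file.  Axioms standard. [this work]
-/

namespace Summit.CriticalPhenomena.PercolationContinuityZ3.Theorems.SahiLatin

open Finset

variable {κ : Type*} [Fintype κ] [DecidableEq κ]

/-! ## §1  The per-point minimum over admissible patterns (general `κ`, computable) -/

/-- Value of a membership pattern at the point `u`. [this work] -/
def pval (P b Q c : Finset (Pt κ)) (u : Pt κ) (sSS sSO sOS sOO : Bool) : ℤ :=
  (if sSS then dSS P b Q c u else 0) + (if sSO then dSO P b Q c u else 0) + (if sOS then dOS P b Q c u else 0)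
    + (if sOO then dOO P b Q c u else 0)

/-- The minimum of the pattern values over the admissible (nested, forced) patterns at `u`. [this work] -/
def mPat (P b Q c : Finset (Pt κ)) (u : Pt κ) : ℤ :=
  if u ∈ P then
    (if u ∈ Q then min (pval P b Q c u true true true false) (pval P b Q c u true true true true)
     else min (pval P b Q c u true true false false) (min (pval P b Q c u true true true false) (pval P b Q c u true true true true)))
  else
    (if u ∈ Q then min (pval P b Q c u true false true false) (min (pval P b Q c u true true true false) (pval P b Q c u true true true true))
     else min 0 (min (pval P b Q c u true false false false) (min (pval P b Q c u true true false false)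
       (min (pval P b Q c u true false true false) (min (pval P b Q c u true true true false) (pval P b Q c u true true true true))))))

/-! ## §2  The core instances on `[3]^2` -/

/-- The literal `{x : t ≤ x i}` on `[3]^{Fin 2}`. [this work] -/
def lit2 (i : Fin 2) (t : Fin 3) : Finset (Pt (Fin 2)) := univ.filter fun x => t ≤ x i

set_option synthInstance.maxSize 100000 in
set_option synthInstance.maxHeartbeats 400000 in
/-- **Core, thresholds `(2,2)`** (the tight pure bridge). [this work] -/
theorem grid4_core11_22 :
    Grid4 (lit2 0 2) (univ \ lit2 0 2) (lit2 1 2) (univ \ lit2 1 2) :=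
  grid4_of_pointwise (mPat (lit2 0 2) (univ \ lit2 0 2) (lit2 1 2) (univ \ lit2 1 2)) (by decide)
    (by unfold PatternOK; decide)

set_option synthInstance.maxSize 100000 in
set_option synthInstance.maxHeartbeats 400000 in
/-- **Core, thresholds `(2,1)`**. [this work] -/
theorem grid4_core11_21 :
    Grid4 (lit2 0 2) (univ \ lit2 0 2) (lit2 1 1) (univ \ lit2 1 1) :=
  grid4_of_pointwise (mPat (lit2 0 2) (univ \ lit2 0 2) (lit2 1 1) (univ \ lit2 1 1)) (by decide)
    (by unfold PatternOK; decide)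

set_option synthInstance.maxSize 100000 in
set_option synthInstance.maxHeartbeats 400000 in
/-- **Core, thresholds `(1,2)`**. [this work] -/
theorem grid4_core11_12 :
    Grid4 (lit2 0 1) (univ \ lit2 0 1) (lit2 1 2) (univ \ lit2 1 2) :=
  grid4_of_pointwise (mPat (lit2 0 1) (univ \ lit2 0 1) (lit2 1 2) (univ \ lit2 1 2)) (by decide)
    (by unfold PatternOK; decide)

set_option synthInstance.maxSize 100000 in
set_option synthInstance.maxHeartbeats 400000 in
/-- **Core, thresholds `(1,1)`** (tight as well). [this work] -/
theorem grid4_core11_11 :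
    Grid4 (lit2 0 1) (univ \ lit2 0 1) (lit2 1 1) (univ \ lit2 1 1) :=
  grid4_of_pointwise (mPat (lit2 0 1) (univ \ lit2 0 1) (lit2 1 1) (univ \ lit2 1 1)) (by decide)
    (by unfold PatternOK; decide)

end Summit.CriticalPhenomena.PercolationContinuityZ3.Theorems.SahiLatin
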